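import Mathlib.LinearAlgebra.Eigenspace.Pi
import Literature.NumberTheory.EllipticCurves.NewformsEigenpacketProofs
import HarnessLib

/-!
# The newform behind an eigenform of `T_q` (`q ∤ NM`) **and `U_M`** on `S_k(NM, χ)`, `cond χ = N`,
# `M ∤ N` prime: level `N` or `NM`, and `a_M` of the level-`N` newform from the `U_M`-eigenvalue

A proofs-only leaf (theorems only: no definition, no named fact; D-0026), continuing
`NewformsEigenpacketProofs` (`exists_isNewform1_of_eigenpacket`: the packet of a `T_q`-eigenform,
`q ∤` level, is the packet of a newform of some level dividing the level).  Here the level is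
`NM` with `M` a prime not dividing `N`, the nebentypus `χ` has conductor exactly `N`, and the
eigenform `g ∈ S_k(NM, χ)` is ALSO an eigenvector of `U_M`, `U_M g = μ g`.  Then
(`exists_isNewform1_of_eigenpacket_prime_level`):

* the newform `g₀` has level `N' = N` or `N' = NM` (the conductor of the nebentypus divides the
  level of a newform and `N ∣ N' ∣ NM`);
* `a_q(g₀) = a_q` for the primes `q ∤ NM`, and the nebentypus of `g₀` induces `χ`;
* **if `N' = N` then `μ² - a_M(g₀) μ + χ(M) M^{k-1} = 0`**, i.e. `μ` is a root of the Hecke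
  polynomial of `g₀` at the prime `M ∤ N'`, so that `a_M(g₀) = μ + χ(M)M^{k-1}/μ` is recovered from
  the `U_M`-eigenvalue although `M` divides the level of `g`.

This is the classical computation of `U_p` on the `p`-old forms (Atkin–Lehner 1970, §2, Lemmas
13–15; Diamond–Shurman, *A first course in modular forms*, Prop. 5.6.2, second diagram:
on `[α_1]_k f, [α_p]_k f` the operator `U_p` acts by `(T_p, -⟨p⟩; p^{k-1}, 0)`, whose characteristic
polynomial is `X² - a_p(f)X + χ(p)p^{k-1}`), combined with the old/new decomposition and the
independence of the joint eigenspaces of the Hecke packets.  It is the modular-forms substitute for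
the step "Chebotarev density and Brauer–Nesbitt, as explained in [DeSe74]" at the prime `ℓ = M` in
Billerey–Menares 2018, §3.2 (proof of Thm. 2), where the newform attached to a level-`NM`
eigenform may have level `N`.

Proof (assembled from the tree).  Write `g = g_old + g_new` (`isCompl_oldSubspace1_newSubspace1`);
both parts are eigenvectors with the same eigenvalues, the two subspaces being stable under all
`T_q`, `U_q`, `⟨u⟩` (`heckeT_mem_oldSubspace1`, `heckeT_mem_newSubspace1`, `diamondOp_mem_*`).
If `g_new ≠ 0` it is a multiple of a newform of level `NM` (`exists_isNewform1_of_mem_newSubspace1`,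
Diamond–Shurman Thm. 5.8.2 with the Main Lemma `atkinLehnerMainLemma1_holds`).  If `g_new = 0`,
`g` is old: the old subspace is spanned by the images `[α_d]_k b` of packet vectors `b` of the lower
levels `M₁` (`span_packetVectors_eq_top`), each lying in the joint eigenspace of a newform packet at
level `NM` (`isPacketVector_degeneracyMap1`); by the independence of the joint generalised
eigenspaces (`Module.End.independent_iInf_maxGenEigenspace_of_forall_mapsTo`) `g` lies in the span
of those with the packet of `g`; for these the diamond part of the packet is `χ`, of conductor `N`,
so `N ∣ M₀ ∣ M₁` (Mathlib `DirichletCharacter.conductor_changeLevel`,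
`mem_conductorSet_iff_conductor_dvd`), whence `M₁ = M₀ = N` and `d ∈ {1, M}`; on `[α_1]_k b` and
`[α_M]_k b` the operator `U_M` satisfies `U_M² - a_M(b) U_M + χ(M) M^{k-1} = 0`
(`heckeT_degeneracyMap1_of_dvd_of_not_dvd`, `heckeT_degeneracyMap1_mul`), so the product of these
quadratic polynomials over a finite spanning family kills `g`, and evaluating at the eigenvalue `μ`
(`Module.End.aeval_apply_of_hasEigenvector`) one factor vanishes at `μ`.

## References

* A. O. L. Atkin, J. Lehner, *Hecke operators on `Γ₀(m)`*, Math. Ann. 185 (1970), 134–160, §2.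
  [AtkinLehner1970]
* F. Diamond, J. Shurman, *A first course in modular forms*, GTM 228 (2005): Prop. 5.6.2,
  Thm. 5.8.2, Thm. 5.8.3. [DiamondShurman2005]
* N. Billerey, R. Menares, *Strong modularity of reducible Galois representations*, Trans. Amer.
  Math. Soc. 370 (2018), 967–986, §3.2. [BillereyMenares2018]
-/

noncomputable section

open scoped MatrixGroups ModularForm Polynomial

open CongruenceSubgroup Polynomial

namespace Literature.NumberTheory.EllipticCurves.ModularForms

/-! ### Two pieces of linear algebra -/

section LinearAlgebra

variable {V : Type*} [AddCommGroup V] [Module ℂ V]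

/-- If `T` preserves two disjoint submodules `p`, `q` and `y + z` (`y ∈ p`, `z ∈ q`) is an
eigenvector of `T`, then so are `y` and `z`, with the same eigenvalue. [folklore] -/
theorem apply_eq_smul_and_of_add_of_disjoint {p q : Submodule ℂ V} (hpq : Disjoint p q)
    (T : V →ₗ[ℂ] V) (hTp : ∀ v ∈ p, T v ∈ p) (hTq : ∀ v ∈ q, T v ∈ q) {y z : V} (hy : y ∈ p)
    (hz : z ∈ q) {c : ℂ} (h : T (y + z) = c • (y + z)) : T y = c • y ∧ T z = c • z := by
  rw [map_add, smul_add] at h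
  have h2 : (T y - c • y) + (T z - c • z) = 0 := by
    rw [← add_sub_add_comm, sub_eq_zero]
    exact h
  have h1 : T y - c • y = -(T z - c • z) := eq_neg_of_add_eq_zero_left h2
  have hp' : T y - c • y ∈ p := p.sub_mem (hTp y hy) (p.smul_mem c hy)
  have hq' : T y - c • y ∈ q := by
    rw [h1]
    exact q.neg_mem (q.sub_mem (hTq z hz) (q.smul_mem c hz))
  have h0 : T y - c • y = 0 := (Submodule.disjoint_def.mp hpq) _ hp' hq'
  refine ⟨sub_eq_zero.mp h0, ?_⟩
  rw [h0, zero_add] at h2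
  exact sub_eq_zero.mp h2

/-- The quadratic polynomial `X² - α X + β`. [folklore] -/
private theorem aeval_quadratic_apply (U : Module.End ℂ V) (α β : ℂ) (x : V) :
    aeval U (X ^ 2 - C α * X + C β) x = U (U x) - α • U x + β • x := by
  simp only [map_add, map_sub, map_mul, aeval_X, aeval_C, LinearMap.add_apply,
    LinearMap.sub_apply, Module.End.mul_apply, Module.algebraMap_end_apply, pow_two]

/-- Evaluation of the quadratic polynomial `X² - α X + β`. [folklore] -/
private theorem eval_quadratic (α β μ : ℂ) :
    (X ^ 2 - C α * X + C β : ℂ[X]).eval μ = μ ^ 2 - α * μ + β := by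
  simp only [eval_add, eval_sub, eval_mul, eval_pow, eval_X, eval_C]

end LinearAlgebra

/-! ### `U_M` on the `M`-old forms coming from level `N` -/

section UOld

variable {N M : ℕ} [NeZero N] [NeZero M] {k : ℤ}

/-- Changing the (propositionally equal) index `d` of a degeneracy map. [folklore] -/
theorem degeneracyMap1_congr_index {L d d' : ℕ} [NeZero L] [NeZero d] [NeZero d'] (h : d = d')
    (f : CuspForm (Gamma1 N) k) : degeneracyMap1 N L d k f = degeneracyMap1 N L d' k f := by
  subst h
  rfl

/-- **`U_M` on `[α_1]_k b` and `[α_M]_k b`** (Diamond–Shurman Prop. 5.6.2, second diagram), for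
`M ∤ N` prime and `b ∈ S_k(Γ₁(N))` with `T_M b = α b`, `⟨M⟩ b = c b`:
`U_M [α_1] b = α [α_1] b - c [α_M] b` and `U_M [α_M] b = M^{k-1} [α_1] b`. [cite: DiamondShurman2005, Prop. 5.6.2] -/
theorem heckeT_degeneracyMap1_one_and_self (hM : M.Prime) (hMN : ¬ M ∣ N)
    {b : CuspForm (Gamma1 N) k} {α c : ℂ} (hTb : heckeT (Gamma1 N) k M b = α • b)
    (hDb : diamondOp N k (M : ZMod N) b = c • b) :
    heckeT (Gamma1 (N * M)) k M (degeneracyMap1 N (N * M) 1 k b) =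
        α • degeneracyMap1 N (N * M) 1 k b - c • degeneracyMap1 N (N * M) M k b ∧
      heckeT (Gamma1 (N * M)) k M (degeneracyMap1 N (N * M) M k b) =
        ((M : ℂ) ^ (k - 1)) • degeneracyMap1 N (N * M) 1 k b := by
  haveI : NeZero (1 * M) := ⟨by rw [one_mul]; exact hM.ne_zero⟩
  haveI : NeZero (M * 1) := ⟨by rw [mul_one]; exact hM.ne_zero⟩
  have hML : M ∣ N * M := dvd_mul_left M N
  have h1 : N * 1 ∣ N * M := by rw [mul_one]; exact dvd_mul_right N M
  have h2 : N * (1 * M) ∣ N * M := by simp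
  have h3 : N * (M * 1) ∣ N * M := by simp
  have hM1 : ¬ M ∣ 1 := fun h ↦ hM.one_lt.ne' (Nat.dvd_one.mp h)
  constructor
  · have h := heckeT_degeneracyMap1_of_dvd_of_not_dvd k (M := N) (N := N * M) (d := 1) (p := M)
      h1 h2 hM hML hMN hM1 b
    rw [hTb, hDb, map_smul, map_smul] at h
    rw [h, degeneracyMap1_congr_index (one_mul M) b]
  · have h := heckeT_degeneracyMap1_mul k (M := N) (N := N * M) (e := 1) (p := M) h3 h1 hM hML b
    rw [degeneracyMap1_congr_index (mul_one M) b] at h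
    exact h

/-- **The Hecke polynomial at `M` of a level-`N` eigenform kills its two `M`-old images under
`U_M`**: with `Q = X² - α X + c M^{k-1}` (`T_M b = α b`, `⟨M⟩ b = c b`, `M ∤ N` prime),
`Q(U_M) [α_1]_k b = 0` and `Q(U_M) [α_M]_k b = 0` (the characteristic polynomial of the matrix
`(α, M^{k-1}; -c, 0)` of Diamond–Shurman Prop. 5.6.2). [cite: DiamondShurman2005, Prop. 5.6.2; AtkinLehner1970, §2] -/
theorem aeval_heckePolynomial_heckeT_degeneracyMap1_eq_zero (hM : M.Prime) (hMN : ¬ M ∣ N)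
    {b : CuspForm (Gamma1 N) k} {α c : ℂ} (hTb : heckeT (Gamma1 N) k M b = α • b)
    (hDb : diamondOp N k (M : ZMod N) b = c • b) {d : ℕ} [NeZero d] (hd : d = 1 ∨ d = M) :
    aeval (heckeT (Gamma1 (N * M)) k M) (X ^ 2 - C α * X + C (c * (M : ℂ) ^ (k - 1)))
      (degeneracyMap1 N (N * M) d k b) = 0 := by
  obtain ⟨hU1, hUM⟩ := heckeT_degeneracyMap1_one_and_self hM hMN hTb hDb
  set U := heckeT (Gamma1 (N * M)) k M
  set x₁ := degeneracyMap1 N (N * M) 1 k b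
  set xM := degeneracyMap1 N (N * M) M k b
  rw [aeval_quadratic_apply]
  rcases hd with rfl | hdM
  · change U (U x₁) - α • U x₁ + (c * (M : ℂ) ^ (k - 1)) • x₁ = 0
    rw [hU1, map_sub, map_smul, map_smul, hU1, hUM, smul_sub, smul_smul, smul_smul, smul_smul,
      mul_comm α c]
    abel
  · obtain rfl : M = d := hdM.symm
    change U (U xM) - α • U xM + (c * (M : ℂ) ^ (k - 1)) • xM = 0
    rw [hUM, map_smul, hU1, smul_sub, smul_smul, smul_smul, smul_smul, mul_comm _ α,
      mul_comm c]
    abel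

end UOld

/-! ### The theorem -/

section Main

variable {N M : ℕ} [NeZero N] [NeZero M] {k : ℤ}

set_option maxHeartbeats 800000 in
/-- **The newform behind an eigenform of the `T_q` (`q ∤ NM`) and of `U_M` in `S_k(NM, χ)`,
`cond χ = N`, `M ∤ N` prime.**  Let `χ` be a primitive Dirichlet character modulo `N`, `M` a prime
not dividing `N`, and `g ∈ S_k(Γ₁(NM))`, `g ≠ 0`, with `⟨u⟩ g = χ(u) g`, `T_q g = a_q g` for every
prime `q ∤ NM` and `U_M g = μ g`.  Then there are `N' ∈ {N, NM}` and a newform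
`g₀ ∈ S_k(Γ₁(N'))` with `a_q(g₀) = a_q` for all primes `q ∤ NM`, whose nebentypus induces `χ`, and
such that `μ² - a_M(g₀) μ + χ(M) M^{k-1} = 0` when `N' = N` (Atkin–Lehner 1970, §2;
Diamond–Shurman Prop. 5.6.2 and Thms. 5.8.2–5.8.3; this is how the eigenvalue of `T_M` on the
newform of level `N` is read off the `U_M`-eigenvalue at level `NM`).
[cite: DiamondShurman2005, Prop. 5.6.2, Thm. 5.8.2, Thm. 5.8.3; AtkinLehner1970, §2] -/
theorem exists_isNewform1_of_eigenpacket_prime_level (hM : M.Prime) (hMN : ¬ M ∣ N)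
    {χ : DirichletCharacter ℂ N} (hχ : χ.IsPrimitive) {g : CuspForm (Gamma1 (N * M)) k}
    (hg0 : g ≠ 0)
    (hgχ : g ∈ nebentypusSubspace (N * M) k (DirichletCharacter.changeLevel (dvd_mul_right N M) χ))
    {a : ℕ → ℂ}
    (hT : ∀ (q : ℕ) (hq : q.Prime), ¬ q ∣ N * M →
      (haveI : NeZero q := ⟨hq.ne_zero⟩; heckeT (Gamma1 (N * M)) k q g) = a q • g)
    {μ : ℂ} (hU : heckeT (Gamma1 (N * M)) k M g = μ • g) :
    ∃ (N' : ℕ) (_ : NeZero N') (hN' : N' ∣ N * M) (g₀ : CuspForm (Gamma1 N') k), IsNewform1 g₀ ∧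
      (N' = N ∨ N' = N * M) ∧
      (∀ q : ℕ, q.Prime → ¬ q ∣ N * M → cuspCoeff g₀ q = a q) ∧
      (N' = N → μ ^ 2 - cuspCoeff g₀ M * μ + χ M * (M : ℂ) ^ (k - 1) = 0) ∧
      DirichletCharacter.changeLevel hN' (nebentypus g₀) =
        DirichletCharacter.changeLevel (dvd_mul_right N M) χ := by
  classical
  have hNL : N ∣ N * M := dvd_mul_right N M
  have hML : M ∣ N * M := dvd_mul_left M N
  set χL := DirichletCharacter.changeLevel hNL χ with hχL
  -- ### the conductor of `χL` is `N`: if `χL` is induced from level `M₀ ∣ NM` then `N ∣ M₀`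
  have hcond : χL.conductor = N := by
    rw [hχL, DirichletCharacter.conductor_changeLevel]
    exact hχ
  have hNdvd : ∀ {M₀ : ℕ} (hM₀ : M₀ ∣ N * M) (ψ : DirichletCharacter ℂ M₀),
      DirichletCharacter.changeLevel hM₀ ψ = χL → N ∣ M₀ := by
    intro M₀ hM₀ ψ h
    have hmem : M₀ ∈ χL.conductorSet :=
      (DirichletCharacter.mem_conductorSet_iff _).mpr ⟨hM₀, ψ, h.symm⟩
    rw [← hcond]
    exact DirichletCharacter.conductor_dvd_of_mem_conductorSet _ hmem
  -- diamonds on `g`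
  have hgD : ∀ u : (ZMod (N * M))ˣ, diamondOp (N * M) k (u : ZMod (N * M)) g = χL u • g :=
    mem_nebentypusSubspace_iff_diamondOp.mp hgχ
  -- ### `g = y + z`, `y` old, `z` new; both are eigenvectors with the same eigenvalues
  have htop : g ∈ oldSubspace1 (N * M) k ⊔ newSubspace1 (N * M) k := by
    rw [(isCompl_oldSubspace1_newSubspace1 (N * M) k).sup_eq_top]
    exact Submodule.mem_top
  obtain ⟨y, hy, z, hz, hyz⟩ := Submodule.mem_sup.mp htop
  have hdisj := disjoint_oldSubspace1_newSubspace1_holds (N * M) k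
  have hzT : ∀ (q : ℕ) (hq : q.Prime), ¬ q ∣ N * M →
      (haveI : NeZero q := ⟨hq.ne_zero⟩; heckeT (Gamma1 (N * M)) k q z) = a q • z := by
    intro q hq hqL
    haveI : NeZero q := ⟨hq.ne_zero⟩
    refine (apply_eq_smul_and_of_add_of_disjoint hdisj (heckeT (Gamma1 (N * M)) k q)
      (fun v hv ↦ heckeT_mem_oldSubspace1 (N * M) k hq hv)
      (fun v hv ↦ heckeT_mem_newSubspace1 (N * M) k hq hv)
      hy hz ?_).2
    rw [hyz]
    exact hT q hq hqL
  have hzD : ∀ u : (ZMod (N * M))ˣ, diamondOp (N * M) k (u : ZMod (N * M)) z = χL u • z := by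
    intro u
    refine (apply_eq_smul_and_of_add_of_disjoint hdisj (diamondOp (N * M) k (u : ZMod (N * M)))
      (fun v hv ↦ diamondOp_mem_oldSubspace1 (N * M) k _ hv)
      (fun v hv ↦ diamondOp_mem_newSubspace1 (N * M) k _ hv)
      hy hz ?_).2
    rw [hyz]
    exact hgD u
  by_cases hz0 : z ≠ 0
  · -- ### Case 1: a new component — a newform of level `NM`
    obtain ⟨f, hf, hzf⟩ := exists_isNewform1_of_mem_newSubspace1
      (atkinLehnerMainLemma1_holds (N * M) k) hz hz0 a hzT (fun u ↦ ⟨_, hzD u⟩)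
    set c : ℂ := cuspCoeff z 1 with hc_def
    change z = c • f at hzf
    have hf0 : f ≠ 0 := by
      rintro rfl
      rw [smul_zero] at hzf
      exact hz0 hzf
    have hc : c ≠ 0 := by
      rintro h0
      rw [h0, zero_smul] at hzf
      exact hz0 hzf
    -- `a_q(f) = a_q` for `q ∤ NM`
    have hfq : ∀ q : ℕ, q.Prime → ¬ q ∣ N * M → cuspCoeff f q = a q := by
      intro q hq hqL
      haveI : NeZero q := ⟨hq.ne_zero⟩
      have h1 : heckeT (Gamma1 (N * M)) k q f = cuspCoeff f q • f := by
        have := heckeT_eq_heckeEigenvalue_smul f q (hf.2.1 q hq)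
        rwa [IsNewform1.heckeEigenvalue_eq_coeff_holds hf hq] at this
      have h2 := hzT q hq hqL
      rw [hzf, map_smul, h1, smul_smul, smul_smul] at h2
      have h3 : c * cuspCoeff f q = a q * c := smul_left_injective ℂ hf0 h2
      rw [mul_comm] at h3
      exact mul_right_cancel₀ hc h3
    -- the nebentypus of `f` is `χL`
    have hfneb : nebentypus f = χL := by
      have hfD := mem_nebentypusSubspace_iff_diamondOp.mp
        (IsNewform1.mem_nebentypusSubspace_nebentypus_holds hf)
      refine MulChar.ext fun u ↦ ?_
      have h1 := hfD u
      have h2 := hzD u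
      rw [hzf, map_smul, h1, smul_smul, smul_smul] at h2
      have h3 : c * nebentypus f u = χL u * c := smul_left_injective ℂ hf0 h2
      rw [mul_comm] at h3
      exact mul_right_cancel₀ hc h3
    refine ⟨N * M, inferInstance, dvd_rfl, f, hf, Or.inr rfl, hfq, fun h ↦ ?_, ?_⟩
    · exact absurd ((mul_eq_left₀ (NeZero.ne N)).mp h) hM.ne_one
    · rw [DirichletCharacter.changeLevel_self]
      exact hfneb
  · -- ### Case 2: `g` is old
    rw [not_ne_iff] at hz0
    rw [hz0, add_zero] at hyz
    subst hyz
    -- the commuting family `{T_q : q ∤ NM} ∪ {⟨u⟩}`, its joint generalised eigenspaces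
    let I : Type := {q : ℕ // q.Prime ∧ ¬ q ∣ N * M} ⊕ (ZMod (N * M))ˣ
    let F : I → Module.End ℂ (CuspForm (Gamma1 (N * M)) k) :=
      Sum.elim (fun q ↦ haveI : NeZero q.1 := ⟨q.2.1.ne_zero⟩; heckeT (Gamma1 (N * M)) k q.1)
        (fun u ↦ diamondOp (N * M) k (u : ZMod (N * M)))
    have hcomm : ∀ i j : I, Commute (F i) (F j) := by
      rintro (⟨p, hp, hpM⟩ | u) (⟨q, hq, hqM⟩ | v)
      · haveI : NeZero p := ⟨hp.ne_zero⟩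
        haveI : NeZero q := ⟨hq.ne_zero⟩
        exact heckeT_comm_holds (N * M) k p q
      · haveI : NeZero p := ⟨hp.ne_zero⟩
        exact heckeT_diamondOp_comm_holds (N := N * M) (k := k) p (v : ZMod (N * M))
      · haveI : NeZero q := ⟨hq.ne_zero⟩
        exact (heckeT_diamondOp_comm_holds (N := N * M) (k := k) q (u : ZMod (N * M))).symm
      · exact diamondOp_comm (N * M) k _ _
    let V : (I → ℂ) → Submodule ℂ (CuspForm (Gamma1 (N * M)) k) :=
      fun θ ↦ ⨅ i, (F i).maxGenEigenspace (θ i)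
    have hind : iSupIndep V :=
      Module.End.independent_iInf_maxGenEigenspace_of_forall_mapsTo F fun i j φ ↦
        Module.End.mapsTo_maxGenEigenspace_of_comm (hcomm j i) φ
    let pk : (ℕ → ℂ) → DirichletCharacter ℂ (N * M) → I → ℂ :=
      fun a' χ' ↦ Sum.elim (fun q ↦ a' q.1) (fun u ↦ χ' (u : ZMod (N * M)))
    have hmemV : ∀ {b : CuspForm (Gamma1 (N * M)) k} {a' : ℕ → ℂ}
        {χ' : DirichletCharacter ℂ (N * M)},
        (∀ (q : ℕ) (hq : q.Prime), ¬ q ∣ N * M →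
          (haveI : NeZero q := ⟨hq.ne_zero⟩; heckeT (Gamma1 (N * M)) k q b) = a' q • b) →
        (∀ u : (ZMod (N * M))ˣ, diamondOp (N * M) k (u : ZMod (N * M)) b = χ' u • b) →
        b ∈ V (pk a' χ') := by
      intro b a' χ' hT' hD'
      change b ∈ ⨅ i, (F i).maxGenEigenspace (pk a' χ' i)
      rw [Submodule.mem_iInf]
      rintro (⟨q, hq, hqM⟩ | u)
      · exact Module.End.eigenspace_le_maxGenEigenspace
          (Module.End.mem_eigenspace_iff.mpr (hT' q hq hqM))
      · exact Module.End.eigenspace_le_maxGenEigenspace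
          (Module.End.mem_eigenspace_iff.mpr (hD' u))
    set θ₀ : I → ℂ := pk a χL with hθ₀
    have hgV : y ∈ V θ₀ := hmemV hT hgD
    -- ### the `θ₀`-sources: `[α_d]_k b`, `d ∈ {1, M}`, `b` a level-`N` packet vector with packet `θ₀`
    let S₀ : Set (CuspForm (Gamma1 (N * M)) k) :=
      {x | ∃ (d : ℕ) (_ : NeZero d) (b g₀ : CuspForm (Gamma1 N) k), (d = 1 ∨ d = M) ∧
        IsNewform1 g₀ ∧
        (∀ (q : ℕ) (hq : q.Prime), ¬ q ∣ N →
          (haveI : NeZero q := ⟨hq.ne_zero⟩; heckeT (Gamma1 N) k q b) = cuspCoeff g₀ q • b) ∧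
        (∀ u : (ZMod N)ˣ, diamondOp N k (u : ZMod N) b = χ u • b) ∧
        (∀ q : ℕ, q.Prime → ¬ q ∣ N * M → cuspCoeff g₀ q = a q) ∧ nebentypus g₀ = χ ∧
        x = degeneracyMap1 N (N * M) d k b}
    -- the other packets
    let W' : Submodule ℂ (CuspForm (Gamma1 (N * M)) k) := ⨆ θ ∈ {θ : I → ℂ | θ ≠ θ₀}, V θ
    -- ### Claim A: the old subspace lies in `span S₀ ⊔ W'`
    have hA : oldSubspace1 (N * M) k ≤ Submodule.span ℂ S₀ ⊔ W' := by
      rw [oldSubspace1, iSup_le_iff]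
      rintro ⟨⟨M₁, d⟩, hM₁, hMd⟩
      haveI hM₁0 : NeZero M₁ := ⟨(Nat.pos_of_mem_properDivisors hM₁).ne'⟩
      haveI : NeZero d :=
        ⟨fun h ↦ NeZero.ne (N * M) (Nat.eq_zero_of_zero_dvd (by simpa [h] using hMd))⟩
      have hlt : M₁ < N * M := (Nat.mem_properDivisors.mp hM₁).2
      have hM₁L : M₁ ∣ N * M := (dvd_mul_right M₁ d).trans hMd
      dsimp only at hMd ⊢
      rw [LinearMap.range_eq_map, ← span_packetVectors_eq_top M₁ k, Submodule.map_span,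
        Submodule.span_le]
      rintro _ ⟨b, ⟨M₀, _, hM₀, g₀, hg₀, hbT, hbD⟩, rfl⟩
      -- the packet of `x = [α_d] b` at level `NM`
      have hxT : ∀ (q : ℕ) (hq : q.Prime), ¬ q ∣ N * M →
          (haveI : NeZero q := ⟨hq.ne_zero⟩;
            heckeT (Gamma1 (N * M)) k q (degeneracyMap1 M₁ (N * M) d k b)) =
            cuspCoeff g₀ q • degeneracyMap1 M₁ (N * M) d k b := by
        intro q hq hqL
        haveI : NeZero q := ⟨hq.ne_zero⟩
        have hqM₁ : ¬ q ∣ M₁ := fun h ↦ hqL (h.trans hM₁L)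
        have hqd : ¬ q ∣ d := fun h ↦ hqL (h.trans ((dvd_mul_left d M₁).trans hMd))
        rw [heckeT_degeneracyMap1_of_not_dvd k hMd hq hqd
          ⟨fun h ↦ (hqM₁ h).elim, fun h ↦ (hqL h).elim⟩, hbT q hq hqM₁, map_smul]
      have hxD : ∀ u : (ZMod (N * M))ˣ,
          diamondOp (N * M) k (u : ZMod (N * M)) (degeneracyMap1 M₁ (N * M) d k b) =
            DirichletCharacter.changeLevel (hM₀.trans hM₁L) (nebentypus g₀) u •
              degeneracyMap1 M₁ (N * M) d k b := by
        intro u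
        rw [diamondOp_degeneracyMap1 (N * M) k hMd u.isUnit b]
        obtain ⟨u₁, hu₁⟩ := u.isUnit.map (ZMod.castHom hM₁L (ZMod M₁))
        rw [← hu₁, hbD u₁, map_smul, DirichletCharacter.changeLevel_trans _ hM₀ hM₁L,
          DirichletCharacter.changeLevel_eq_cast_of_dvd _ hM₁L u, hu₁, ZMod.castHom_apply]
      set θ : I → ℂ :=
        pk (cuspCoeff g₀) (DirichletCharacter.changeLevel (hM₀.trans hM₁L) (nebentypus g₀))
        with hθdef
      have hxV : degeneracyMap1 M₁ (N * M) d k b ∈ V θ := hmemV hxT hxD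
      by_cases hθ : θ = θ₀
      · -- a `θ₀`-source: then `M₁ = M₀ = N` and `d ∈ {1, M}`
        refine Submodule.mem_sup_left (Submodule.subset_span ?_)
        have hq0 : ∀ q : ℕ, q.Prime → ¬ q ∣ N * M → cuspCoeff g₀ q = a q := by
          intro q hq hqL
          have h := congrFun hθ (.inl ⟨q, hq, hqL⟩)
          simpa only [hθdef, hθ₀, pk, Sum.elim_inl] using h
        have hneb0 : DirichletCharacter.changeLevel (hM₀.trans hM₁L) (nebentypus g₀) = χL := by
          refine MulChar.ext fun u ↦ ?_
          have h := congrFun hθ (.inr u)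
          simpa only [hθdef, hθ₀, pk, Sum.elim_inr] using h
        have hNM₀ : N ∣ M₀ := hNdvd (hM₀.trans hM₁L) (nebentypus g₀) hneb0
        -- `M₁ = N`
        have hNM₁ : N ∣ M₁ := hNM₀.trans hM₀
        have hM₁N : N = M₁ := by
          obtain ⟨e, he⟩ := hNM₁
          have heM : e ∣ M := Nat.dvd_of_mul_dvd_mul_left (NeZero.pos N) (he ▸ hM₁L)
          rcases (Nat.dvd_prime hM).mp heM with h1 | h2
          · rw [he, h1, mul_one]
          · exact absurd (by rw [he, h2]) hlt.ne
        subst hM₁N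
        obtain rfl : N = M₀ := (Nat.dvd_antisymm hM₀ hNM₀).symm
        -- `d ∈ {1, M}`
        have hdM : d ∣ M := Nat.dvd_of_mul_dvd_mul_left (NeZero.pos N) hMd
        have hd : d = 1 ∨ d = M := (Nat.dvd_prime hM).mp hdM
        -- the nebentypus of `g₀` is `χ`
        have hneb : nebentypus g₀ = χ := by
          apply DirichletCharacter.changeLevel_injective hNL
          rw [← hχL]
          exact hneb0
        refine ⟨d, inferInstance, b, g₀, hd, hg₀, hbT, fun u ↦ ?_, hq0, hneb, rfl⟩
        have := hbD u
        rwa [DirichletCharacter.changeLevel_self, hneb] at this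
      · -- another packet
        exact Submodule.mem_sup_right
          (Submodule.mem_iSup_of_mem θ (Submodule.mem_iSup_of_mem (show θ ∈ {θ | θ ≠ θ₀} from hθ) hxV))
    -- ### Claim B: `y ∈ span S₀`
    have hS₀V : Submodule.span ℂ S₀ ≤ V θ₀ := by
      rw [Submodule.span_le]
      rintro x ⟨d, _, b, g₀, hd, hg₀, hbT, hbD, hq0, hneb, rfl⟩
      have hdM : d ∣ M := by rcases hd with rfl | rfl <;> simp
      have hNd : N * d ∣ N * M := mul_dvd_mul_left N hdM
      refine hmemV (fun q hq hqL ↦ ?_) (fun u ↦ ?_)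
      · haveI : NeZero q := ⟨hq.ne_zero⟩
        have hqN : ¬ q ∣ N := fun h ↦ hqL (h.trans hNL)
        have hqM : ¬ q ∣ M := fun h ↦ hqL (h.trans hML)
        have hqd : ¬ q ∣ d := fun h ↦ hqM (h.trans hdM)
        rw [heckeT_degeneracyMap1_of_not_dvd k hNd hq hqd
          ⟨fun h ↦ (hqN h).elim, fun h ↦ (hqL h).elim⟩, hbT q hq hqN, map_smul, hq0 q hq hqL]
      · rw [diamondOp_degeneracyMap1 (N * M) k hNd u.isUnit b]
        obtain ⟨u₁, hu₁⟩ := u.isUnit.map (ZMod.castHom hNL (ZMod N))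
        rw [← hu₁, hbD u₁, map_smul, hχL,
          DirichletCharacter.changeLevel_eq_cast_of_dvd _ hNL u, hu₁, ZMod.castHom_apply]
    have hyS : y ∈ Submodule.span ℂ S₀ := by
      obtain ⟨s, hs, w, hw, hsw⟩ := Submodule.mem_sup.mp (hA hy)
      have hwV : w ∈ V θ₀ := by
        have : w = y - s := eq_sub_of_add_eq' hsw
        rw [this]
        exact (V θ₀).sub_mem hgV (hS₀V hs)
      have hdis : Disjoint (V θ₀) W' :=
        hind.disjoint_biSup (show θ₀ ∉ {θ : I → ℂ | θ ≠ θ₀} from fun h ↦ h rfl)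
      have hw0 : w = 0 := (Submodule.disjoint_def.mp hdis) w hwV hw
      rw [hw0, add_zero] at hsw
      rw [← hsw]
      exact hs
    -- ### Claim C: a finite spanning family of sources and the product of their Hecke polynomials
    obtain ⟨T, hTS, hyT⟩ := Submodule.mem_span_finite_of_mem_span hyS
    have hdat : ∀ x : CuspForm (Gamma1 (N * M)) k, x ∈ (T : Set _) →
        ∃ α : ℂ, aeval (heckeT (Gamma1 (N * M)) k M)
            (X ^ 2 - C α * X + C (χ M * (M : ℂ) ^ (k - 1))) x = 0 ∧
          ∃ g₀ : CuspForm (Gamma1 N) k, IsNewform1 g₀ ∧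
            (∀ q : ℕ, q.Prime → ¬ q ∣ N * M → cuspCoeff g₀ q = a q) ∧ nebentypus g₀ = χ ∧
            cuspCoeff g₀ M = α := by
      intro x hx
      obtain ⟨d, _, b, g₀, hd, hg₀, hbT, hbD, hq0, hneb, rfl⟩ := hTS hx
      refine ⟨cuspCoeff g₀ M, ?_, g₀, hg₀, hq0, hneb, rfl⟩
      have hTb : heckeT (Gamma1 N) k M b = cuspCoeff g₀ M • b := hbT M hM hMN
      have hu : IsUnit ((M : ℕ) : ZMod N) := (ZMod.isUnit_prime_iff_not_dvd hM).mpr hMN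
      obtain ⟨uM, huM⟩ := hu
      have hDb : diamondOp N k (M : ZMod N) b = χ M • b := by
        rw [← huM, hbD uM, huM]
      exact aeval_heckePolynomial_heckeT_degeneracyMap1_eq_zero hM hMN hTb hDb hd
    choose! α hα hα' using hdat
    set U := heckeT (Gamma1 (N * M)) k M with hUdef
    set Q : CuspForm (Gamma1 (N * M)) k → ℂ[X] :=
      fun x ↦ X ^ 2 - C (α x) * X + C (χ M * (M : ℂ) ^ (k - 1)) with hQ
    set P : ℂ[X] := ∏ x ∈ T, Q x with hP
    -- `P(U)` kills every element of `T`, hence `y`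
    have hPx : ∀ x ∈ T, aeval U P x = 0 := by
      intro x hx
      rw [hP, ← Finset.prod_erase_mul _ _ hx, map_mul, Module.End.mul_apply]
      change aeval U (∏ x ∈ T.erase x, Q x) (aeval U (Q x) x) = 0
      rw [hα x hx, map_zero]
    have hPy : aeval U P y = 0 := by
      obtain ⟨c, -, hc⟩ := Submodule.mem_span_finset.mp hyT
      rw [← hc, map_sum]
      refine Finset.sum_eq_zero fun x hx ↦ ?_
      rw [map_smul, hPx x hx, smul_zero]
    -- ### evaluating at the eigenvalue `μ`
    have heig : Module.End.HasEigenvector U μ y :=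
      ⟨Module.End.mem_eigenspace_iff.mpr hU, hg0⟩
    have hPμ : P.eval μ = 0 := by
      have h := Module.End.aeval_apply_of_hasEigenvector (p := P) heig
      rw [hPy] at h
      exact (smul_eq_zero.mp h.symm).resolve_right hg0
    rw [hP, eval_prod, Finset.prod_eq_zero_iff] at hPμ
    obtain ⟨x, hx, hxμ⟩ := hPμ
    rw [hQ, eval_quadratic] at hxμ
    obtain ⟨g₀, hg₀, hq0, hneb, hgα⟩ := hα' x hx
    refine ⟨N, inferInstance, hNL, g₀, hg₀, Or.inl rfl, hq0, fun _ ↦ ?_, by rw [hneb]⟩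
    rw [hgα]
    exact hxμ

end Main

end Literature.NumberTheory.EllipticCurves.ModularForms

end
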